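import Literature.Computability.QuantumComplexity.ExactSearchQueryComplexity
import Literature.Computability.QuantumComplexity.HammingPairAdversary
import Mathlib.Data.ZMod.Basic
import Mathlib.Data.Nat.Choose.Sum
import HarnessLib

/-!
# Exact quantum query complexity of THRESHOLD and EXACT-weight tests: the Ambainis–Iraids–Smotrovs floors, and the von zur Gathen–Roche prime case

Topic `Computability/QuantumComplexity`. Two printed statements about the EXACT measure `Q_E`
(`quantumQueryComplexity 0` of the tree's query model `QQueryAlg`, `QuantumQuery.lean`) of
weight-determined Boolean functions `x ↦ g(|x|)` on `N` black-box bits (`|x| = Grover.hw x`), both resting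
on Beals–Buhrman–Cleve–Mosca–de Wolf's `Q_E(OR_N) = N` [BealsEtAl2001, Prop. 6.1 / Cor. 6.2] (tree:
`ExactSearch.quantumQueryComplexity_zero_orFn`, file `ExactSearchQueryComplexity.lean`).

1. A. Ambainis, J. Iraids, J. Smotrovs, *Exact quantum query complexity of EXACT and THRESHOLD*, TQC 2013
   (arXiv:1302.1235; held text `paper:arxiv-1302.1235`), §3–§4:

   > **Definition 1.** The function `EXACT_k^n` is a Boolean function of `n` variables being true iff
   > exactly `k` of the variables are equal to `1`. […]
   > **Proposition 1.** If `g` is a partial function such that `g(x) = f(x)` whenever `g` is defined on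
   > `x`, then `Q_E(g) ≤ Q_E(f)`.
   > **Proposition 2.** `Q_E(EXACT_k^n) ≥ max{k, n−k}`. *Proof.* Assume that `k ≤ n/2`. The other case is
   > symmetric. Define `g(x_{k+1}, …, x_n) = EXACT_k^n(1, …, 1, x_{k+1}, …, x_n)`. Observe that `g` is in
   > fact negation of the `OR` function on `n−k` bits which we know [BBC+98] to take `n−k` queries to
   > compute. Therefore by virtue of Proposition 1 no algorithm for `EXACT_k^n` may use less than `n−k`
   > queries. □ (p. 5)
   > **Definition 2.** The function `Th_k^n` is a Boolean function of `n` variables being true iff at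
   > least `k` of the variables are equal to `1`. […]
   > **Proposition 3.** `Q_E(Th_k^n) ≥ max{k, n−k+1}`. *Proof.* Assume that `k ≤ n/2`. The other case is
   > symmetric. Define `g(x_k, x_{k+1}, …, x_n) = Th_k^n(1, …, 1, x_k, x_{k+1}, …, x_n)`. Observe that `g`
   > is in fact the `OR` function on `n−k+1` bits which we know [BBC+98] takes `n−k+1` queries to
   > compute. □ (p. 6)

   The matching ALGORITHMS (Thm. 1 `Q_E(EXACT_k^{2k}) ≤ k`, Cor. 1 `Q_E(EXACT_k^n) ≤ max{k, n−k}`, Thm. 2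
   `Q_E(MAJ_{2k+1}) ≤ k+1`, Cor. 2 `Q_E(Th_k^n) ≤ max{k, n−k+1}` for `0 < k < n`) are NOT typed here: what
   is typed is the FLOOR half of the two printed equalities, with equality only where the floor is `N`
   (the tree's `N`-query exact algorithm, `quantumQueryComplexity_le_holds`).

2. R. Beals, H. Buhrman, R. Cleve, M. Mosca, R. de Wolf, *Quantum lower bounds by polynomials*, J. ACM 48
   (2001) [BealsEtAl2001] (held text `paper:arxiv-quant-ph_9802049`, p. 7 L129–137):

   > **Theorem 4.6 (Von zur Gathen, Roche).** If `f` is non-constant and symmetric, then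
   > `deg(f) = N − O(N^{0.548})`. If, in addition, `N+1` is prime, then `deg(f) = N`.
   > **Corollary 4.7.** If `f` is non-constant and symmetric, then `Q_E(f) ≥ N/2 − O(N^{0.548})`. If, in
   > addition, `N+1` is prime, then `Q_E(f) ≥ N/2`.

   Only the SECOND clauses (the prime case) are typed; the first clauses rest on primes in short
   intervals and are not typed. (Original: J. von zur Gathen, J. R. Roche, *Polynomials with two values*,
   Combinatorica 17 (1997) 345–362 — read here through [BealsEtAl2001].)

## What is typed, and how

* **The sub-function principle for exact algorithms** (Prop. 1 in the form both printed proofs use it,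
  joined with [BBC+98]'s `Q_E(OR) = Q_E(AND) = ` number of bits): if `A` computes `f` with error `0` and
  an input `x₁` is ISOLATED on the sub-cube with free coordinates `F` — every other input agreeing with
  `x₁` off `F` has the other value of `f` — then `|F| ≤ A.queries`
  (`card_le_queries_of_isolated`). Instead of simulating a restricted algorithm, the Beals et al.
  amplitude argument (Lemma 4.1: every final amplitude has multilinear degree `≤ T`, tree
  `ExactSearch.hasDegreeLE_re_finalState` / `hasDegreeLE_im_finalState`) is run directly on the sub-cube:
  the sub-cube character `x ↦ [x ≡ x₁ off F]·χ_F(x)` has pure high degree `|F| − 1` (flip one free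
  coordinate, `sum_subcube_walsh_mul_walsh_eq_zero`), so it annihilates every function of degree
  `< |F|` (`HasPureHighDegree.sum_mul_eq_zero`, tree), while it pairs a function supported on `{x₁}`
  within the sub-cube to `±` its value at `x₁` (`sum_mul_subcubeChar_of_isolated`).
* **Prop. 2 / Prop. 3** for the tree's Hamming weight `Grover.hw`:
  `max t (N − t) ≤ Q_E(x ↦ [hw x = t])` (`t ≤ N`, `le_quantumQueryComplexity_zero_exactWeight`) and
  `max t (N − t + 1) ≤ Q_E(x ↦ [t ≤ hw x])` (`1 ≤ t ≤ N`, `le_quantumQueryComplexity_zero_threshold`);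
  the isolated inputs are the indicator of a `t`-set (free set = the set, resp. its complement) and of a
  `(t−1)`-set (free set = its complement). End cases as equalities: `Q_E(AND_N) = N`
  (`quantumQueryComplexity_zero_threshold_self`), `Q_E([hw = N]) = Q_E([hw = 0]) = N`; the majority
  display `k + 1 ≤ Q_E(MAJ_{2k+1})` (`succ_le_quantumQueryComplexity_zero_majority`; `= k+1` is Thm. 2,
  not typed). The functions are written `fun x => decide (t ≤ Grover.hw x)` / `decide (Grover.hw x = t)`,
  which is `symFn N (fun w => decide (t ≤ w))` of `Literature/Barriers/PQCSecurity/` by `rfl` (no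
  Barriers file is imported here).
* **Thm. 4.6 / Cor. 4.7, prime case**, in TOP-COEFFICIENT form: for every `g : ℕ → Bool`,
  `Σ_x [g(hw x)]·χ_[N](x) = Σ_{j ≤ N} (−1)^j·C(N,j)·[g j]` (`sum_ind_hw_mul_walsh_univ`), an integer; when
  `N + 1 = p` is prime, `C(N, j) ≡ (−1)^j (mod p)` (`cast_choose_sub_one`), so the integer is
  `≡ #{j ≤ N : g j}` and is NONZERO as soon as `g` is non-constant on `{0, …, N}` (that count lies in
  `[1, N]`): `sum_choose_mul_neg_one_pow_ne_zero` (the integer form) and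
  `one_le_abs_sum_ind_hw_mul_walsh_univ` (`|Σ| ≥ 1`, i.e. the top Walsh coefficient of `[g ∘ hw]` has
  modulus `≥ 2^{−N}`; `walsh` is the tree's character of `Literature/Probability/RandomGraphs/LowDegree.lean`,
  the one `Barriers/PQCSecurity/ExactWeightTestFloor.topCoeff` is built from). With the acceptance polynomial of an error-free algorithm (degree
  `≤ 2T`, tree `exists_acceptPolynomial`) this gives Cor. 4.7's `N ≤ 2·Q_E(x ↦ g(hw x))` for `N + 1`
  prime (`le_two_mul_quantumQueryComplexity_zero_of_prime`).

Everything is proved; no named facts, no new definitions. The zero-error (Las Vegas) measure `Q_0` of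
[BealsEtAl2001] is not a tree object and is not typed.

## References

* A. Ambainis, J. Iraids, J. Smotrovs, *Exact quantum query complexity of EXACT and THRESHOLD*, in:
  TQC 2013, LIPIcs 22, pp. 263–269; arXiv:1302.1235 — §3 Def. 1, Prop. 1, Prop. 2 (p. 5 L60–75), §4
  Def. 2, Cor. 2, Prop. 3 (p. 6 L46–75). [AmbainisIraidsSmotrovs2013]
* R. Beals, H. Buhrman, R. Cleve, M. Mosca, R. de Wolf, *Quantum lower bounds by polynomials*, J. ACM
  48(4) (2001) 778–797; arXiv:quant-ph/9802049 — Lemma 4.1, Lemma 4.2, Thm. 4.6, Cor. 4.7 (p. 7),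
  Prop. 6.1 / Cor. 6.2 (p. 12). [BealsEtAl2001]
* J. von zur Gathen, J. R. Roche, *Polynomials with two values*, Combinatorica 17(3) (1997) 345–362
  (the source of Thm. 4.6; read through [BealsEtAl2001]).
-/

noncomputable section

open Finset
open Literature.Computability.Cryptography
open Literature.Computability.Complexity
open Literature.Probability.RandomGraphs.LowDegree (walsh sgn sgn_true sgn_false)
open Literature.Computability.Complexity.ApproximateDegree (HasPureHighDegree)
open Literature.Computability.QuantumComplexity.ExactSearch
open Literature.Computability.QuantumComplexity.HammingPair (supp ofSupp mem_supp supp_ofSupp ofSupp_supp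
  hw_eq_card_supp hw_ofSupp supp_injective)

namespace Literature.Computability.QuantumComplexity.ExactThreshold

variable {N : ℕ}

/-! ### Sub-cube characters: flipping one free coordinate -/

/-- Flipping the `i`-th bit twice is the identity. [folklore] -/
private theorem update_not_update_not (x : Fin N → Bool) (i : Fin N) :
    Function.update (Function.update x i (!x i)) i (!(Function.update x i (!x i)) i) = x := by
  rw [Function.update_self, Bool.not_not, Function.update_idem, Function.update_eq_self]

/-- Flipping the `i`-th bit negates every character containing `i` and fixes the others. [folklore] -/
private theorem walsh_update_not (S : Finset (Fin N)) (x : Fin N → Bool) (i : Fin N) :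
    walsh S (Function.update x i (!x i)) = if i ∈ S then -walsh S x else walsh S x := by
  unfold walsh
  by_cases hi : i ∈ S
  · rw [if_pos hi, ← Finset.mul_prod_erase S _ hi, ← Finset.mul_prod_erase S (fun j => sgn (x j)) hi,
      Function.update_self]
    have h : ∏ j ∈ S.erase i, sgn (Function.update x i (!x i) j) = ∏ j ∈ S.erase i, sgn (x j) :=
      Finset.prod_congr rfl fun j hj => by rw [Function.update_of_ne (Finset.ne_of_mem_erase hj)]
    rw [h]
    cases x i <;> simp
  · rw [if_neg hi]
    exact Finset.prod_congr rfl fun j hj => by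
      rw [Function.update_of_ne (ne_of_mem_of_not_mem hj hi)]

/-- A character is never zero (`χ_S(x) = ±1`). [folklore] -/
private theorem walsh_ne_zero (S : Finset (Fin N)) (x : Fin N → Bool) : walsh S x ≠ 0 := by
  unfold walsh
  exact Finset.prod_ne_zero_iff.2 fun j _ => by cases x j <;> simp

/-- The sub-cube through `x₁` with free coordinates `F`, weighted by its own character `χ_F`, is
orthogonal to every character `χ_S` missing a free coordinate: flip that coordinate.
[cite: BealsEtAl2001, §3 (multilinear polynomials; `deg`)] -/
theorem sum_subcube_walsh_mul_walsh_eq_zero (x₁ : Fin N → Bool) (F S : Finset (Fin N)) {i : Fin N}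
    (hiF : i ∈ F) (hiS : i ∉ S) :
    ∑ x : Fin N → Bool, (if (∀ j, j ∉ F → x j = x₁ j) then walsh F x else 0) * walsh S x = 0 := by
  classical
  set h : (Fin N → Bool) → ℝ :=
    fun x => (if (∀ j, j ∉ F → x j = x₁ j) then walsh F x else 0) * walsh S x with hh
  have hinv : Function.Involutive (fun x : Fin N → Bool => Function.update x i (!x i)) :=
    fun x => update_not_update_not x i
  have hodd : ∀ x, h (Function.update x i (!x i)) = -h x := by
    intro x
    simp only [hh]
    have hcond : (∀ j, j ∉ F → Function.update x i (!x i) j = x₁ j) ↔ (∀ j, j ∉ F → x j = x₁ j) := by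
      refine forall_congr' fun j => forall_congr' fun hj => ?_
      rw [Function.update_of_ne (ne_of_mem_of_not_mem hiF hj).symm]
    rw [walsh_update_not, walsh_update_not, if_pos hiF, if_neg hiS]
    by_cases hc : ∀ j, j ∉ F → x j = x₁ j
    · rw [if_pos (hcond.2 hc), if_pos hc]; ring
    · rw [if_neg (fun h' => hc (hcond.1 h')), if_neg hc]; ring
  have hsum : ∑ x, h x = ∑ x, h (Function.update x i (!x i)) :=
    (Equiv.sum_comp hinv.toPerm h).symm
  have hneg : ∑ x, h (Function.update x i (!x i)) = -∑ x, h x := by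
    rw [← Finset.sum_neg_distrib]
    exact Finset.sum_congr rfl fun x _ => hodd x
  show ∑ x, h x = 0
  linarith

/-- Hence the sub-cube character `[x ≡ x₁ off F]·χ_F` has pure high degree `d` for every `d < |F|`.
[cite: BealsEtAl2001, §3] -/
theorem hasPureHighDegree_subcubeChar (x₁ : Fin N → Bool) (F : Finset (Fin N)) {d : ℕ}
    (hd : d < F.card) :
    HasPureHighDegree d (fun x : Fin N → Bool => if (∀ j, j ∉ F → x j = x₁ j) then walsh F x else 0) := by
  intro S hS
  have hFS : ¬ F ⊆ S := fun h => absurd (Finset.card_le_card h) (by omega)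
  obtain ⟨i, hiF, hiS⟩ := Finset.not_subset.1 hFS
  exact sum_subcube_walsh_mul_walsh_eq_zero x₁ F S hiF hiS

/-- A cube function of multilinear degree `≤ d < |F|` is annihilated by the sub-cube character.
[cite: BealsEtAl2001, Lemma 4.1 / §3] -/
theorem sum_mul_subcubeChar_eq_zero (x₁ : Fin N → Bool) (F : Finset (Fin N)) {d : ℕ}
    (hd : d < F.card) {p : (Fin N → Bool) → ℝ}
    (hp : Literature.Combinatorics.Optimization.HasDegreeLE d p) :
    ∑ x, p x * (if (∀ j, j ∉ F → x j = x₁ j) then walsh F x else 0) = 0 :=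
  (hasPureHighDegree_subcubeChar x₁ F hd).sum_mul_eq_zero hp

/-- A function vanishing on the sub-cube except at `x₁` pairs with the sub-cube character to
`p(x₁)·χ_F(x₁)`. [cite: BealsEtAl2001, Prop. 6.1 (proof)] -/
theorem sum_mul_subcubeChar_of_isolated (x₁ : Fin N → Bool) (F : Finset (Fin N))
    {p : (Fin N → Bool) → ℝ} (hp : ∀ x, (∀ j, j ∉ F → x j = x₁ j) → x ≠ x₁ → p x = 0) :
    ∑ x, p x * (if (∀ j, j ∉ F → x j = x₁ j) then walsh F x else 0) = p x₁ * walsh F x₁ := by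
  rw [Finset.sum_eq_single x₁]
  · rw [if_pos (fun j _ => rfl)]
  · intro x _ hx
    by_cases hc : ∀ j, j ∉ F → x j = x₁ j
    · rw [hp x hc hx, zero_mul]
    · rw [if_neg hc, mul_zero]
  · intro h
    exact absurd (Finset.mem_univ _) h

/-- **Degree of an isolated point.** If `p` has multilinear degree `≤ d`, vanishes on the sub-cube through
`x₁` with free set `F` except at `x₁`, and `p(x₁) ≠ 0`, then `|F| ≤ d` (for `F = [N]`, `x₁ = 0⃗` this is
"`p` must have degree at least `deg(OR) = N`"). [cite: BealsEtAl2001, Prop. 6.1 (proof)] -/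
theorem card_le_of_hasDegreeLE_of_isolated (x₁ : Fin N → Bool) (F : Finset (Fin N)) {d : ℕ}
    {p : (Fin N → Bool) → ℝ} (hdeg : Literature.Combinatorics.Optimization.HasDegreeLE d p)
    (hp : ∀ x, (∀ j, j ∉ F → x j = x₁ j) → x ≠ x₁ → p x = 0) (hne : p x₁ ≠ 0) : F.card ≤ d := by
  by_contra hlt
  have h0 := sum_mul_subcubeChar_eq_zero x₁ F (not_le.1 hlt) hdeg
  rw [sum_mul_subcubeChar_of_isolated x₁ F hp] at h0
  exact mul_ne_zero hne (walsh_ne_zero F x₁) h0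

/-! ### Born-rule bookkeeping on the accepting side -/

open Classical in
/-- If the acceptance probability on `x` is `0`, every accepting amplitude vanishes at `x`.
[cite: BealsEtAl2001, §2] -/
theorem finalState_eq_zero_of_acceptProb_eq_zero (A : QQueryAlg N) {x : Fin N → Bool}
    (hx : A.acceptProb x ≤ 0) {s : Fin N × Bool × A.W} (hs : s ∈ A.accept) :
    A.finalState x s = 0 := by
  have h0 : A.acceptProb x = 0 := le_antisymm hx (A.acceptProb_nonneg x)
  unfold QQueryAlg.acceptProb at h0
  have hterm := (Finset.sum_eq_zero_iff_of_nonneg (fun t _ => by positivity)).1 h0 s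
    (Finset.mem_filter.2 ⟨Finset.mem_univ _, hs⟩)
  exact norm_eq_zero.1 (by simpa using hterm)

open Classical in
/-- If the acceptance probability on `x` is `1`, some accepting amplitude is nonzero at `x`.
[cite: BealsEtAl2001, §2] -/
theorem exists_finalState_ne_zero_of_acceptProb_eq_one (A : QQueryAlg N) {x : Fin N → Bool}
    (hx : 1 ≤ A.acceptProb x) : ∃ s, s ∈ A.accept ∧ A.finalState x s ≠ 0 := by
  have hpos : A.acceptProb x ≠ 0 := by linarith
  unfold QQueryAlg.acceptProb at hpos
  obtain ⟨s, hs, hne⟩ := Finset.exists_ne_zero_of_sum_ne_zero hpos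
  refine ⟨s, (Finset.mem_filter.1 hs).2, fun h0 => hne ?_⟩
  rw [h0, norm_zero, sq, mul_zero]

/-! ### The sub-function principle for exact algorithms (Prop. 1 with [BBC+98]) -/

/-- An amplitude of an exact `T`-query algorithm that vanishes on a sub-cube except at `x₁`, where it is
nonzero, forces `|F| ≤ T`. [cite: AmbainisIraidsSmotrovs2013, Prop. 1] -/
theorem card_le_queries_of_amplitude (A : QQueryAlg N) (x₁ : Fin N → Bool) (F : Finset (Fin N))
    (s : Fin N × Bool × A.W) (hvan : ∀ x, (∀ j, j ∉ F → x j = x₁ j) → x ≠ x₁ → A.finalState x s = 0)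
    (hne : A.finalState x₁ s ≠ 0) : F.card ≤ A.queries := by
  by_contra hlt
  apply hne
  apply Complex.ext
  · have h := card_le_of_hasDegreeLE_of_isolated x₁ F (hasDegreeLE_re_finalState A s)
      (p := fun x => (A.finalState x s).re)
      (fun x hx hne' => by show (A.finalState x s).re = 0; rw [hvan x hx hne', Complex.zero_re])
    by_contra hre
    exact hlt (h hre)
  · have h := card_le_of_hasDegreeLE_of_isolated x₁ F (hasDegreeLE_im_finalState A s)
      (p := fun x => (A.finalState x s).im)
      (fun x hx hne' => by show (A.finalState x s).im = 0; rw [hvan x hx hne', Complex.zero_im])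
    by_contra him
    exact hlt (h him)

/-- **The sub-function principle** ([AIS13] Prop. 1 joined with [BBC+98] `Q_E(OR_m) = Q_E(AND_m) = m`,
proved by the amplitude argument on the sub-cube): if `A` computes `f` with error `0` on all inputs and
`x₁` is ISOLATED on the sub-cube with free coordinates `F` — every other input agreeing with `x₁` off `F`
has the other value — then `A` makes at least `|F|` queries. [cite: AmbainisIraidsSmotrovs2013, Prop. 1] -/
theorem card_le_queries_of_isolated (A : QQueryAlg N) {f : (Fin N → Bool) → Bool}
    (hA : A.ComputesWithError 0 Set.univ f) (x₁ : Fin N → Bool) (F : Finset (Fin N))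
    (hiso : ∀ x, (∀ j, j ∉ F → x j = x₁ j) → x ≠ x₁ → f x ≠ f x₁) : F.card ≤ A.queries := by
  cases hx₁ : f x₁
  · -- `f x₁ = 0`: some non-accepting amplitude is nonzero at `x₁` and vanishes elsewhere on the sub-cube
    have h0 : A.acceptProb x₁ ≤ 0 := (hA x₁ (Set.mem_univ _)).2 hx₁
    obtain ⟨s, hs, hne⟩ := exists_finalState_ne_zero_of_acceptProb_eq_zero A h0
    refine card_le_queries_of_amplitude A x₁ F s (fun x hx hne' => ?_) hne
    have hfx : f x = true := by
      have := hiso x hx hne'; rw [hx₁] at this; simpa using this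
    have h1 : 1 - (0 : ℝ) ≤ A.acceptProb x := (hA x (Set.mem_univ _)).1 hfx
    exact finalState_eq_zero_of_acceptProb_eq_one A (by simpa using h1) hs
  · -- `f x₁ = 1`: some accepting amplitude is nonzero at `x₁` and vanishes elsewhere on the sub-cube
    have h1 : 1 - (0 : ℝ) ≤ A.acceptProb x₁ := (hA x₁ (Set.mem_univ _)).1 hx₁
    obtain ⟨s, hs, hne⟩ := exists_finalState_ne_zero_of_acceptProb_eq_one A (by simpa using h1)
    refine card_le_queries_of_amplitude A x₁ F s (fun x hx hne' => ?_) hne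
    have hfx : f x = false := by
      have := hiso x hx hne'; rw [hx₁] at this; simpa using this
    have h0 : A.acceptProb x ≤ 0 := (hA x (Set.mem_univ _)).2 hfx
    exact finalState_eq_zero_of_acceptProb_eq_zero A h0 hs

/-! ### Hamming weight on the sub-cubes through the indicator of a set -/

/-- Inputs agreeing with `1_S` off `S` have support inside `S`; if different from `1_S`, strictly, so
their weight is `< |S|` ("`EXACT_k^k = AND_k`", the symmetric case of Prop. 2 / Prop. 3).
[cite: AmbainisIraidsSmotrovs2013, Prop. 2 (proof)] -/
theorem hw_lt_card_of_agree_off (S : Finset (Fin N)) {x : Fin N → Bool}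
    (hx : ∀ j, j ∉ S → x j = ofSupp S j) (hne : x ≠ ofSupp S) : Grover.hw x < S.card := by
  rw [hw_eq_card_supp]
  refine Finset.card_lt_card (Finset.ssubset_iff_subset_ne.2 ⟨fun j hj => ?_, fun h => hne ?_⟩)
  · by_contra hjS
    have := hx j hjS
    rw [mem_supp.1 hj, ofSupp, decide_eq_false hjS] at this
    exact Bool.noConfusion this
  · rw [← ofSupp_supp x, h]

/-- Inputs agreeing with `1_S` on `S` have support containing `S`; if different from `1_S`, strictly, so
their weight is `> |S|` ("`g` is negation of `OR` on the remaining bits", Prop. 2; "`g` is `OR`",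
Prop. 3). [cite: AmbainisIraidsSmotrovs2013, Prop. 2 / Prop. 3 (proofs)] -/
theorem card_lt_hw_of_agree_on (S : Finset (Fin N)) {x : Fin N → Bool}
    (hx : ∀ j, j ∉ Sᶜ → x j = ofSupp S j) (hne : x ≠ ofSupp S) : S.card < Grover.hw x := by
  rw [hw_eq_card_supp]
  refine Finset.card_lt_card (Finset.ssubset_iff_subset_ne.2 ⟨fun j hj => ?_, fun h => hne ?_⟩)
  · have := hx j (fun h => (Finset.mem_compl.1 h) hj)
    rw [ofSupp, decide_eq_true hj] at this
    exact mem_supp.2 this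
  · rw [← ofSupp_supp x, ← h]

/-- The complement of a `t`-subset of `[N]` has `N − t` elements. [folklore] -/
private theorem card_compl_eq {S : Finset (Fin N)} {t : ℕ} (hS : S.card = t) : Sᶜ.card = N - t := by
  rw [Finset.card_compl, Fintype.card_fin, hS]

/-- A `t`-subset of `[N]` exists for `t ≤ N`. [folklore] -/
private theorem exists_card_eq {t : ℕ} (ht : t ≤ N) : ∃ S : Finset (Fin N), S.card = t := by
  obtain ⟨S, -, hS⟩ := Finset.exists_subset_card_eq (s := (Finset.univ : Finset (Fin N))) (n := t)
    (by rw [Finset.card_univ, Fintype.card_fin]; exact ht)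
  exact ⟨S, hS⟩

/-! ### [AIS13] Proposition 2: `Q_E(EXACT_t^N) ≥ max{t, N − t}` -/

/-- **[AIS13] Prop. 2 (floor for every algorithm).** An algorithm computing the exact-weight test
`[hw x = t]` (`t ≤ N`) with error `0` on all inputs makes at least `max t (N − t)` queries.
[cite: AmbainisIraidsSmotrovs2013, Prop. 2] -/
theorem le_queries_of_computesWithError_zero_exactWeight (A : QQueryAlg N) {t : ℕ} (ht : t ≤ N)
    (hA : A.ComputesWithError 0 Set.univ fun x => decide (Grover.hw x = t)) :
    max t (N - t) ≤ A.queries := by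
  obtain ⟨S, hS⟩ := exists_card_eq ht
  refine max_le ?_ ?_
  · -- free set `S`, isolated input `1_S`: the others have weight `< t`
    rw [← hS]
    refine card_le_queries_of_isolated A hA (ofSupp S) S fun x hx hne => ?_
    have hlt := hw_lt_card_of_agree_off S hx hne
    rw [hw_ofSupp, hS] at *
    simp [Nat.ne_of_lt hlt]
  · -- free set `Sᶜ`, isolated input `1_S`: the others have weight `> t`
    rw [← card_compl_eq hS]
    refine card_le_queries_of_isolated A hA (ofSupp S) Sᶜ fun x hx hne => ?_
    have hlt := card_lt_hw_of_agree_on S hx hne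
    rw [hw_ofSupp, hS] at *
    simp [Nat.ne_of_gt hlt]

/-- **[AIS13] Prop. 2.** `max{t, N − t} ≤ Q_E(EXACT_t^N)` for `t ≤ N` (the printed equality's upper half,
Cor. 1, is an algorithm and is not typed). [cite: AmbainisIraidsSmotrovs2013, Prop. 2] -/
theorem le_quantumQueryComplexity_zero_exactWeight {t : ℕ} (ht : t ≤ N) :
    max t (N - t) ≤ quantumQueryComplexity 0 (fun x : Fin N → Bool => decide (Grover.hw x = t)) := by
  rcases Nat.eq_zero_or_pos N with rfl | hN
  · have : t = 0 := by omega
    subst this; exact Nat.zero_le _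
  · haveI : NeZero N := NeZero.of_pos hN
    obtain ⟨A, hq, hA⟩ := exists_queries_eq_quantumQueryComplexityOn (N := N) (le_refl (0 : ℝ))
      Set.univ (fun x : Fin N → Bool => decide (Grover.hw x = t))
    change max t (N - t) ≤ quantumQueryComplexityOn 0 Set.univ _
    rw [← hq]
    exact le_queries_of_computesWithError_zero_exactWeight A ht hA

/-- `Q_E([hw x = N]) = N` (`EXACT_N^N = AND_N`; upper bound: `N` queries always suffice).
[cite: AmbainisIraidsSmotrovs2013, Prop. 2] -/
theorem quantumQueryComplexity_zero_exactWeight_self :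
    quantumQueryComplexity 0 (fun x : Fin N → Bool => decide (Grover.hw x = N)) = N :=
  le_antisymm (quantumQueryComplexity_le_holds 0 le_rfl _)
    (by simpa using le_quantumQueryComplexity_zero_exactWeight (N := N) (t := N) le_rfl)

/-- `Q_E([hw x = 0]) = N` (`EXACT_0^N = ¬OR_N`). [cite: AmbainisIraidsSmotrovs2013, Prop. 2] -/
theorem quantumQueryComplexity_zero_exactWeight_zero :
    quantumQueryComplexity 0 (fun x : Fin N → Bool => decide (Grover.hw x = 0)) = N :=
  le_antisymm (quantumQueryComplexity_le_holds 0 le_rfl _)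
    (by simpa using le_quantumQueryComplexity_zero_exactWeight (N := N) (t := 0) (Nat.zero_le _))

/-! ### [AIS13] Proposition 3: `Q_E(Th_t^N) ≥ max{t, N − t + 1}` -/

/-- **[AIS13] Prop. 3 (floor for every algorithm).** An algorithm computing the threshold test
`[t ≤ hw x]` (`1 ≤ t ≤ N`) with error `0` on all inputs makes at least `max t (N − t + 1)` queries.
[cite: AmbainisIraidsSmotrovs2013, Prop. 3] -/
theorem le_queries_of_computesWithError_zero_threshold (A : QQueryAlg N) {t : ℕ} (ht₁ : 1 ≤ t)
    (ht : t ≤ N) (hA : A.ComputesWithError 0 Set.univ fun x => decide (t ≤ Grover.hw x)) :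
    max t (N - t + 1) ≤ A.queries := by
  refine max_le ?_ ?_
  · -- free set a `t`-set `S`, isolated input `1_S`: the others have weight `< t`
    obtain ⟨S, hS⟩ := exists_card_eq ht
    rw [← hS]
    refine card_le_queries_of_isolated A hA (ofSupp S) S fun x hx hne => ?_
    have hlt := hw_lt_card_of_agree_off S hx hne
    rw [hw_ofSupp, hS] at *
    simp [Nat.not_le_of_lt hlt]
  · -- free set the complement of a `(t−1)`-set `S`, isolated input `1_S`: the others have weight `≥ t`
    obtain ⟨S, hS⟩ := exists_card_eq (N := N) (t := t - 1) (by omega)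
    have hc : Sᶜ.card = N - t + 1 := by rw [card_compl_eq hS]; omega
    rw [← hc]
    refine card_le_queries_of_isolated A hA (ofSupp S) Sᶜ fun x hx hne => ?_
    have hlt := card_lt_hw_of_agree_on S hx hne
    rw [hw_ofSupp, hS] at *
    have h1 : t ≤ Grover.hw x := by omega
    have h2 : ¬ t ≤ t - 1 := by omega
    simp [h1, h2]

/-- **[AIS13] Prop. 3.** `max{t, N − t + 1} ≤ Q_E(Th_t^N)` for `1 ≤ t ≤ N` (the printed equality's upper
half, Cor. 2, is an algorithm and is not typed; `t = 1` is `Q_E(OR_N) = N`,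
`ExactSearch.quantumQueryComplexity_zero_orFn`). [cite: AmbainisIraidsSmotrovs2013, Prop. 3] -/
theorem le_quantumQueryComplexity_zero_threshold {t : ℕ} (ht₁ : 1 ≤ t) (ht : t ≤ N) :
    max t (N - t + 1) ≤ quantumQueryComplexity 0 (fun x : Fin N → Bool => decide (t ≤ Grover.hw x)) := by
  haveI : NeZero N := NeZero.of_pos (by omega)
  obtain ⟨A, hq, hA⟩ := exists_queries_eq_quantumQueryComplexityOn (N := N) (le_refl (0 : ℝ))
    Set.univ (fun x : Fin N → Bool => decide (t ≤ Grover.hw x))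
  change max t (N - t + 1) ≤ quantumQueryComplexityOn 0 Set.univ _
  rw [← hq]
  exact le_queries_of_computesWithError_zero_threshold A ht₁ ht hA

/-- `Q_E(AND_N) = Q_E([N ≤ hw x]) = N` for `N ≥ 1` (`Th_N^N = AND_N`; the floor `max N 1 = N`, the
ceiling the tree's `N`-query algorithm). [cite: AmbainisIraidsSmotrovs2013, Prop. 3] -/
theorem quantumQueryComplexity_zero_threshold_self (hN : 1 ≤ N) :
    quantumQueryComplexity 0 (fun x : Fin N → Bool => decide (N ≤ Grover.hw x)) = N :=
  le_antisymm (quantumQueryComplexity_le_holds 0 le_rfl _)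
    ((le_max_left _ _).trans (le_quantumQueryComplexity_zero_threshold hN le_rfl))

/-- Majority display: `k + 1 ≤ Q_E(MAJ_{2k+1})` (`MAJ_{2k+1} = Th_{k+1}^{2k+1}`; the printed value is
`= k + 1`, Thm. 2, whose algorithm is not typed). [cite: AmbainisIraidsSmotrovs2013, Prop. 3 / Thm. 2] -/
theorem succ_le_quantumQueryComplexity_zero_majority (k : ℕ) :
    k + 1 ≤ quantumQueryComplexity 0 (fun x : Fin (2 * k + 1) → Bool => decide (k + 1 ≤ Grover.hw x)) :=
  (le_max_left _ _).trans (le_quantumQueryComplexity_zero_threshold (N := 2 * k + 1) (by omega) (by omega))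

/-! ### [BealsEtAl2001] Thm. 4.6 / Cor. 4.7, the prime case (von zur Gathen–Roche) -/

/-- `χ_[N](x) = (−1)^{|x|}`. [cite: BealsEtAl2001, §3] -/
theorem walsh_univ_eq_neg_one_pow_hw (x : Fin N → Bool) : walsh univ x = (-1 : ℝ) ^ Grover.hw x := by
  unfold walsh Grover.hw
  have h : ∏ i, sgn (x i) = ∏ i, (if x i = true then (-1 : ℝ) else 1) :=
    Finset.prod_congr rfl fun i _ => by cases x i <;> simp
  rw [h, Finset.prod_ite, Finset.prod_const_one, mul_one, Finset.prod_const]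

/-- Regrouping a weight-determined sum by weight: `Σ_x G(|x|) = Σ_{j ≤ N} C(N, j)·G(j)`.
[cite: BealsEtAl2001, Lemma 3.2 (symmetrization)] -/
theorem sum_hw_eq_sum_choose (G : ℕ → ℝ) :
    ∑ x : Fin N → Bool, G (Grover.hw x) = ∑ j ∈ range (N + 1), (N.choose j : ℝ) * G j := by
  let e : (Fin N → Bool) ≃ Finset (Fin N) :=
    { toFun := supp, invFun := ofSupp, left_inv := ofSupp_supp, right_inv := supp_ofSupp }
  have h1 : ∑ x : Fin N → Bool, G (Grover.hw x) = ∑ S : Finset (Fin N), G S.card := by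
    refine Fintype.sum_equiv e _ _ fun x => ?_
    rw [hw_eq_card_supp]; rfl
  rw [h1, ← Finset.powerset_univ, Finset.sum_powerset_apply_card]
  simp only [Finset.card_univ, Fintype.card_fin, nsmul_eq_mul]

/-- **The top Walsh coefficient of a weight-determined indicator**:
`Σ_x [g(|x|)]·χ_[N](x) = Σ_{j ≤ N} (−1)^j·C(N,j)·[g j]`. [cite: BealsEtAl2001, Lemma 3.2 / §3] -/
theorem sum_ind_hw_mul_walsh_univ (g : ℕ → Bool) :
    ∑ x : Fin N → Bool, (if g (Grover.hw x) = true then (1 : ℝ) else 0) * walsh univ x =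
      ∑ j ∈ range (N + 1), (N.choose j : ℝ) * ((-1 : ℝ) ^ j * (if g j = true then 1 else 0)) := by
  have h : ∀ x : Fin N → Bool, (if g (Grover.hw x) = true then (1 : ℝ) else 0) * walsh univ x =
      (fun n : ℕ => (-1 : ℝ) ^ n * (if g n = true then 1 else 0)) (Grover.hw x) := by
    intro x; rw [walsh_univ_eq_neg_one_pow_hw]; ring
  simp_rw [h]
  exact sum_hw_eq_sum_choose (fun n : ℕ => (-1 : ℝ) ^ n * (if g n = true then 1 else 0))

/-- The same sum as an INTEGER. [cite: BealsEtAl2001, Thm. 4.6] -/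
theorem sum_ind_hw_mul_walsh_univ_eq_intCast (g : ℕ → Bool) :
    ∑ x : Fin N → Bool, (if g (Grover.hw x) = true then (1 : ℝ) else 0) * walsh univ x =
      ((∑ j ∈ range (N + 1), (N.choose j : ℤ) * ((-1 : ℤ) ^ j * (if g j = true then 1 else 0)) : ℤ) :
        ℝ) := by
  rw [sum_ind_hw_mul_walsh_univ]
  push_cast
  refine Finset.sum_congr rfl fun j _ => ?_
  split_ifs <;> simp

/-- `C(p−1, j) ≡ (−1)^j (mod p)` for `j ≤ p − 1` (Pascal's rule and `p ∣ C(p, j)` for `0 < j < p`).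
[folklore] -/
private theorem cast_choose_sub_one {p : ℕ} (hp : p.Prime) {j : ℕ} (hj : j ≤ p - 1) :
    (((p - 1).choose j : ℕ) : ZMod p) = (-1) ^ j := by
  induction j with
  | zero => simp
  | succ j ih =>
    have h1 : (p - 1).choose j + (p - 1).choose (j + 1) = p.choose (j + 1) := by
      have h := Nat.choose_succ_succ' (p - 1) j
      rw [Nat.sub_add_cancel hp.one_le] at h
      exact h.symm
    have h2 : ((p.choose (j + 1) : ℕ) : ZMod p) = 0 := by
      rw [ZMod.natCast_eq_zero_iff]
      exact hp.dvd_choose_self (by omega) (by omega)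
    have h3 := congrArg (fun n : ℕ => (n : ZMod p)) h1
    simp only [Nat.cast_add, ih (by omega), h2] at h3
    rw [pow_succ]
    linear_combination h3

/-- **[BealsEtAl2001] Thm. 4.6, prime case, as a congruence.** For `N + 1 = p` prime the integer
`Σ_{j ≤ N} (−1)^j·C(N,j)·[g j]` is `≡ #{j ≤ N : g j}` (mod `p`). [cite: BealsEtAl2001, Thm. 4.6] -/
theorem intCast_sum_eq_card (hp : (N + 1).Prime) (g : ℕ → Bool) :
    ((∑ j ∈ range (N + 1), (N.choose j : ℤ) * ((-1 : ℤ) ^ j * (if g j = true then 1 else 0)) : ℤ) :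
      ZMod (N + 1)) = (((range (N + 1)).filter fun j => g j = true).card : ℕ) := by
  push_cast
  rw [Finset.card_filter, Nat.cast_sum, Finset.sum_congr rfl]
  intro j hj
  have hjN : j ≤ N := by have := Finset.mem_range.1 hj; omega
  have hc : ((N.choose j : ℕ) : ZMod (N + 1)) = (-1) ^ j := by
    have := cast_choose_sub_one hp (j := j) (by simpa using hjN)
    simpa using this
  rw [hc, ← mul_assoc, ← mul_pow, neg_mul_neg, one_mul, one_pow, one_mul]
  split_ifs <;> simp

/-- **[BealsEtAl2001] Thm. 4.6 (von zur Gathen–Roche), prime case, INTEGER form.** If `N + 1` is prime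
and `g` is non-constant on `{0, …, N}`, the integer `Σ_{j ≤ N} C(N,j)·(−1)^j·[g j]` is nonzero (its residue
mod `N + 1` is the count `#{j ≤ N : g j} ∈ [1, N]`). [cite: BealsEtAl2001, Thm. 4.6] -/
theorem sum_choose_mul_neg_one_pow_ne_zero (hp : (N + 1).Prime) (g : ℕ → Bool)
    (hg : ∃ i j, i ≤ N ∧ j ≤ N ∧ g i ≠ g j) :
    (∑ j ∈ range (N + 1), (N.choose j : ℤ) * ((-1 : ℤ) ^ j * (if g j = true then 1 else 0))) ≠ 0 := by
  -- the count of `true` weights lies strictly between `0` and `N + 1`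
  set c : ℕ := ((range (N + 1)).filter fun j => g j = true).card with hc
  obtain ⟨i, j, hi, hj, hij⟩ := hg
  have hc0 : 0 < c := by
    rw [hc, Finset.card_pos]
    cases hgi : g i
    · have hgj : g j = true := by
        cases hgj' : g j
        · exact absurd (hgi.trans hgj'.symm) hij
        · rfl
      exact ⟨j, Finset.mem_filter.2 ⟨Finset.mem_range.2 (by omega), hgj⟩⟩
    · exact ⟨i, Finset.mem_filter.2 ⟨Finset.mem_range.2 (by omega), hgi⟩⟩
  have hcN : c < N + 1 := by
    rw [hc]
    have hsub : ((range (N + 1)).filter fun j => g j = true) ⊂ range (N + 1) := by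
      refine Finset.filter_ssubset.2 ?_
      cases hgi : g i
      · exact ⟨i, Finset.mem_range.2 (by omega), by simp [hgi]⟩
      · have hgj : g j = false := by
          cases hgj' : g j
          · rfl
          · exact absurd (hgi.trans hgj'.symm) hij
        exact ⟨j, Finset.mem_range.2 (by omega), by simp [hgj]⟩
    simpa using Finset.card_lt_card hsub
  intro h0
  have hcast := intCast_sum_eq_card hp g
  rw [h0, Int.cast_zero, ← hc] at hcast
  have : (c : ZMod (N + 1)) = 0 := hcast.symm
  rw [ZMod.natCast_eq_zero_iff] at this
  exact absurd (Nat.le_of_dvd hc0 this) (by omega)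

/-- **[BealsEtAl2001] Thm. 4.6 (von zur Gathen–Roche), prime case: `deg(f) = N`.** If `N + 1` is prime
and `g` is non-constant on `{0, …, N}`, the top Walsh coefficient of `x ↦ [g(|x|)]` is a NONZERO integer
multiple of `2^{−N}`: `|Σ_x [g(|x|)]·χ_[N](x)| ≥ 1`. [cite: BealsEtAl2001, Thm. 4.6] -/
theorem one_le_abs_sum_ind_hw_mul_walsh_univ (hp : (N + 1).Prime) (g : ℕ → Bool)
    (hg : ∃ i j, i ≤ N ∧ j ≤ N ∧ g i ≠ g j) :
    1 ≤ |∑ x : Fin N → Bool, (if g (Grover.hw x) = true then (1 : ℝ) else 0) * walsh univ x| := by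
  rw [sum_ind_hw_mul_walsh_univ_eq_intCast]
  have h1 : (1 : ℤ) ≤ |∑ j ∈ range (N + 1), (N.choose j : ℤ) * ((-1 : ℤ) ^ j * (if g j = true then 1 else 0))| :=
    Int.one_le_abs (sum_choose_mul_neg_one_pow_ne_zero hp g hg)
  exact_mod_cast h1

/-- Hence the top coefficient is nonzero. [cite: BealsEtAl2001, Thm. 4.6] -/
theorem sum_ind_hw_mul_walsh_univ_ne_zero (hp : (N + 1).Prime) (g : ℕ → Bool)
    (hg : ∃ i j, i ≤ N ∧ j ≤ N ∧ g i ≠ g j) :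
    ∑ x : Fin N → Bool, (if g (Grover.hw x) = true then (1 : ℝ) else 0) * walsh univ x ≠ 0 := by
  intro h0
  have h := one_le_abs_sum_ind_hw_mul_walsh_univ hp g hg
  rw [h0, abs_zero] at h
  exact absurd h (by norm_num)

/-- The acceptance probability of a `T`-query algorithm has multilinear degree `≤ 2T` on the cube
(Lemma 4.2, in the cube-degree vocabulary `Optimization.HasDegreeLE`). [cite: BealsEtAl2001, Lemma 4.2] -/
theorem hasDegreeLE_acceptProb (A : QQueryAlg N) :
    Literature.Combinatorics.Optimization.HasDegreeLE (2 * A.queries) fun x => A.acceptProb x := by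
  obtain ⟨P, hP, h⟩ := exists_acceptPolynomial A
  exact ⟨P, hP, fun x => (h x).symm⟩

/-- For an error-free algorithm the acceptance probability IS the indicator of `f`.
[cite: BealsEtAl2001, §4 ("in the case of exact computation we must have `P(X) = f(X)`")] -/
theorem acceptProb_eq_ind (A : QQueryAlg N) {f : (Fin N → Bool) → Bool}
    (hA : A.ComputesWithError 0 Set.univ f) (x : Fin N → Bool) :
    A.acceptProb x = if f x = true then 1 else 0 := by
  cases hfx : f x
  · rw [if_neg (by simp)]
    exact le_antisymm ((hA x (Set.mem_univ _)).2 hfx) (A.acceptProb_nonneg x)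
  · rw [if_pos rfl]
    have h1 : 1 - (0 : ℝ) ≤ A.acceptProb x := (hA x (Set.mem_univ _)).1 hfx
    exact le_antisymm (QQueryAlg.acceptProb_le_one' A x) (by simpa using h1)

/-- **[BealsEtAl2001] Cor. 4.7, prime case (floor for every algorithm).** If `N + 1` is prime and `g` is
non-constant on `{0, …, N}`, an algorithm computing `x ↦ g(|x|)` with error `0` on all inputs makes
`2T ≥ N` queries (`deg(f) = N`, Thm. 4.3 `Q_E(f) ≥ deg(f)/2`). [cite: BealsEtAl2001, Cor. 4.7] -/
theorem le_two_mul_queries_of_computesWithError_zero_of_prime (hp : (N + 1).Prime) (g : ℕ → Bool)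
    (hg : ∃ i j, i ≤ N ∧ j ≤ N ∧ g i ≠ g j) (A : QQueryAlg N)
    (hA : A.ComputesWithError 0 Set.univ fun x => g (Grover.hw x)) : N ≤ 2 * A.queries := by
  by_contra hlt
  have hdeg : Literature.Combinatorics.Optimization.HasDegreeLE (2 * A.queries)
      fun x : Fin N → Bool => if g (Grover.hw x) = true then (1 : ℝ) else 0 := by
    obtain ⟨P, hP, h⟩ := hasDegreeLE_acceptProb A
    exact ⟨P, hP, fun x => by rw [h x]; exact acceptProb_eq_ind A hA x⟩
  exact sum_ind_hw_mul_walsh_univ_ne_zero hp g hg (sum_mul_walsh_univ_eq_zero (not_le.1 hlt) hdeg)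

/-- **[BealsEtAl2001] Cor. 4.7, prime case: `Q_E(f) ≥ N/2`** for every non-constant weight-determined
`f = g ∘ |·|` on `N` bits with `N + 1` prime. [cite: BealsEtAl2001, Cor. 4.7] -/
theorem le_two_mul_quantumQueryComplexity_zero_of_prime (hp : (N + 1).Prime) (g : ℕ → Bool)
    (hg : ∃ i j, i ≤ N ∧ j ≤ N ∧ g i ≠ g j) :
    N ≤ 2 * quantumQueryComplexity 0 (fun x : Fin N → Bool => g (Grover.hw x)) := by
  rcases Nat.eq_zero_or_pos N with rfl | hN
  · exact Nat.zero_le _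
  · haveI : NeZero N := NeZero.of_pos hN
    obtain ⟨A, hq, hA⟩ := exists_queries_eq_quantumQueryComplexityOn (N := N) (le_refl (0 : ℝ))
      Set.univ (fun x : Fin N → Bool => g (Grover.hw x))
    change N ≤ 2 * quantumQueryComplexityOn 0 Set.univ _
    rw [← hq]
    exact le_two_mul_queries_of_computesWithError_zero_of_prime hp g hg A hA

end Literature.Computability.QuantumComplexity.ExactThreshold

end
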